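import Summits.QuantumFields.BalabanUV.Beta.GAN24.FibreDetStripOfAnchors
import Summits.QuantumFields.BalabanUV.Beta.GAN24.ArrowScaling

/-!
# `BalabanUV.Beta.GAN24.FibreDetStrip` — binder row G-an2-4 / (CONV-C), road P1-fibre, p1 row **P1-L10** `FibreStrip` ((I3′), the strip half of the K-slot),
# cut «(M4) scaled alias-space Neumann, two anchors» = SKELETON-P1 A5 v0.3 (`HOME/b2b-balaban-gan24-formalise-leaf-16/L10-CUT-M4.md`), row **F7** `FibreDetStrip`,
# part 2: (U1) ON THE WHOLE STRIP AS A FUNCTION OF THE FOUR ROWS F3–F6, in F1c's scaled currency `innerArrow` / `outerArrow`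

NOT IN PRINT; OUR PROOF ATTEMPT (of the road; THIS file is [folklore] bookkeeping: part 1 `GAN24/FibreDetStripOfAnchors` instantiated with F1c `GAN24/ArrowScaling`).
HONEST FRAMING (cell contract, verbatim): «discharging `BetaPertH` makes Bałaban's UV stability UNCONDITIONAL — a real constructive-QFT result; it is NOT the continuum
limit and NOT the Clay problem.»  HONEST DEPENDENCY (verbatim): «continuum YM on T⁴ ⇐ BetaPertH ∧ nine spine estimates (0/9 proved); BetaPertH ⇐ (D1) ∧ (D4) ∧ CAP+tail;
G-an2-4 gates asym, D1 and NE2/3/4.»  No cited fact, no wall binder, no `def`, no `def … : Prop` hypothesis: the four rows enter as EXPLICIT hypotheses (their literal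
conclusions, to be discharged BY NAME by F3 `ArrowAnchorZero`, F4 `ArrowInnerShift`, F5 `ArrowAnchorReal`, F6 `ArrowOuterShift` in the v1.1 append of this file).
Nothing of the K-slot `GAN24.CombesThomas.ConvCK 3 Lc` of (CONV-C) is discharged here; (U1) is NOT proved here unconditionally.  NOT summit progress.

## What is proved
With `Gin p := arrowMat (innerArrow N p)` (inner scaling, anchor `p = 0`) and `Gout q p := arrowMat (outerArrow N q p)` (outer scaling frozen at the real anchor `q`):
* §1 `abs_le_pi_of_mem_BZ` (the two spellings of the Brillouin zone: `B4ContourShift.BZ` vs F1c's `∀ i, |q i| ≤ π`).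
* §2 **`apriori_of_rows`** (one `N`): rows F3/F4/F5/F6 (F6 in re/im form with an abstract modulus `ω`, `ω ≤ Ω` off the inner box) + the explicit smallness
  inequalities on `(ρ₀, κ₀)` ⇒ at every `p ∈ Strip D κ₀` EITHER `|Re p|∞ < ρ₀/2 ∧ IsUnit (arrowMat (innerArrow N p)) ∧ ‖inverse‖ ≤ 2aZ` OR
  `(∃ μ, ρ₀/2 ≤ |Re p μ|) ∧ reVec p ≠ 0 ∧ IsUnit (arrowMat (outerArrow N (reVec p) p)) ∧ ‖inverse‖ ≤ 2aR` — the scaled A-PRIORI BOUND row F8 consumes.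
* §3 **`det_ne_zero_of_rows`** (one `N`, `D = d+1`): the same hypotheses ⇒ `∀ p ∈ Strip (d+1) κ₀, det (trigPolySymbol (stencil (d+1)) pieceMatrix p) ≠ 0`
  (F1c `det_ne_zero_of_isUnit_innerArrow/outerArrow` as the property `P` of part 1's `of_strip`; the outer scaling is nondegenerate because `reVec p ∈ BZ ∖ {0}`).
* §4 **`detStrip_of_rows`**: the rows assumed at every `N = Lc^(j+1)` with `j`-INDEPENDENT constants ⇒
  `∀ j, ∀ p ∈ Strip (d+1) κ₀, det (trigPolySymbol (stencil (d+1)) (pieceMatrix (N := Lc^(j+1))) p) ≠ 0` — LITERALLY the hypothesis `hdet` of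
  `StripRegularPackaging.stripRegularK_of_det_bound` / the typer's `Statements/P1_L10_Targets.DetStrip d Lc κ₀` ((U1), TRIGGER-P1 c1; `κ₀` OUTSIDE `∀ j` — ref2 r15 (b)),
  and **`apriori_of_rows_step`**, the `j`-indexed a-priori bound for F8.
v1.1 (append, after F3–F6 land): `detStrip : ∀ j, ∀ p ∈ Strip (d+1) (κ₀ …), det … ≠ 0` with the four hypotheses discharged BY NAME and `(ρ₀, κ₀)` explicit.
Unit `b2b-balaban-gan24-formalise-leaf-09` (G-an2-4 formalisation swarm, leaf prover 09, gen 6; `CLAIM P1-L10-F7` journal 2026-08-20T00:52Z), 2026-08-20.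
-/

noncomputable section

open Matrix Complex
open scoped Matrix.Norms.L2Operator Real
open Literature.MathematicalPhysics.QuantumFieldTheory.Balaban1983to89
open Literature.MathematicalPhysics.QuantumFieldTheory.Balaban1983to89.Beta
open B4Strip (Strip reVec ofRealVec)
open B4ContourShift (BZ)
open BlochFibreMatrix (stencil pieceMatrix)
open FibreInverseDecay (trigPolySymbol reVec_mem_BZ)
open Summit.QuantumFields.BalabanUV.Beta.GAN24.ArrowOperator (arrowMat)
open Summit.QuantumFields.BalabanUV.Beta.GAN24.ArrowScaling (innerArrow outerArrow det_ne_zero_of_isUnit_innerArrow det_ne_zero_of_isUnit_outerArrow)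
open Summit.QuantumFields.BalabanUV.Beta.GAN24.FibreDetStripOfAnchors (apriori_on_strip of_strip)

namespace Summit.QuantumFields.BalabanUV.Beta.GAN24.FibreDetStrip

/-! ## §1 The two spellings of the Brillouin zone -/

/-- [folklore] `q ∈ BZ D` (the box `Icc (−π) π` of `B4ContourShift`) gives F1c's coordinate form `∀ i, |q i| ≤ π`. -/
theorem abs_le_pi_of_mem_BZ {D : ℕ} {q : Fin D → ℝ} (hq : q ∈ BZ D) (i : Fin D) : |q i| ≤ π :=
  abs_le.mpr ⟨hq.1 i, hq.2 i⟩

/-- [folklore] … and conversely. -/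
theorem mem_BZ_of_abs_le_pi {D : ℕ} {q : Fin D → ℝ} (hq : ∀ i, |q i| ≤ π) : q ∈ BZ D :=
  ⟨fun i => (abs_le.mp (hq i)).1, fun i => (abs_le.mp (hq i)).2⟩

/-! ## §2 The scaled a-priori bound on the strip, as a function of the four rows (one `N`) -/

section OneN

variable {D : ℕ} {N : ℕ} [NeZero N]

/-- [folklore] **THE SCALED A-PRIORI BOUND ON THE STRIP FROM ROWS F3–F6** (one box side `N`; the constants are whatever the rows give — N-free in the cut).
Hypotheses: (F3) inner anchor `aZ`; (F4) inner Lipschitz `cIn` on `‖p μ‖ ≤ r ≤ ρ₁`; (F5) outer anchors `aR` on `BZ ∖ {0}`; (F6) outer Lipschitz in re/im form with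
modulus `ω`, controlled by `Ω` off the inner box; smallness `ρ₀ ≤ ρ₁`, `2aZ·cIn·ρ₀ ≤ 1`, `κ₀ ≤ ρ₀/2`, `κ₀ ≤ η₁`, `2aR·cOut·κ₀·Ω ≤ 1`.  Conclusion: at every
`p ∈ Strip D κ₀`, the inner-scaled arrow matrix (if `|Re p|∞ < ρ₀/2`) or the outer-scaled one anchored at `reVec p ≠ 0` (otherwise) is invertible with
`‖inverse‖ ≤ 2aZ` resp. `≤ 2aR`. -/
theorem apriori_of_rows {aZ aR cIn cOut ρ₁ η₁ ρ₀ κ₀ Ω : ℝ} (ω : (Fin D → ℝ) → ℝ)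
    (hF3 : IsUnit (arrowMat (innerArrow N (0 : Fin D → ℂ))) ∧ ‖(arrowMat (innerArrow N (0 : Fin D → ℂ)))⁻¹‖ ≤ aZ)
    (hF4 : ∀ (p : Fin D → ℂ) (r : ℝ), (∀ μ, ‖p μ‖ ≤ r) → r ≤ ρ₁ →
      ‖arrowMat (innerArrow N p) - arrowMat (innerArrow N 0)‖ ≤ cIn * r)
    (hF5 : ∀ q ∈ BZ D, q ≠ 0 → IsUnit (arrowMat (outerArrow N q (ofRealVec q))) ∧ ‖(arrowMat (outerArrow N q (ofRealVec q)))⁻¹‖ ≤ aR)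
    (hF6 : ∀ q ∈ BZ D, q ≠ 0 → ∀ p : Fin D → ℂ, reVec p = q → ∀ η : ℝ, 0 ≤ η → η ≤ η₁ → (∀ μ, |(p μ).im| ≤ η) →
      ‖arrowMat (outerArrow N q p) - arrowMat (outerArrow N q (ofRealVec q))‖ ≤ cOut * η * ω q)
    (hω : ∀ q ∈ BZ D, (∃ μ, ρ₀ / 2 ≤ |q μ|) → ω q ≤ Ω)
    (haZ : 0 ≤ aZ) (haR : 0 ≤ aR) (hcOut : 0 ≤ cOut) (hρ₀ : 0 < ρ₀) (hρ : ρ₀ ≤ ρ₁) (hsmallIn : 2 * aZ * cIn * ρ₀ ≤ 1)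
    (hκ₀ : 0 ≤ κ₀) (hκ : κ₀ ≤ ρ₀ / 2) (hκη : κ₀ ≤ η₁) (hsmallOut : 2 * aR * cOut * κ₀ * Ω ≤ 1)
    {p : Fin D → ℂ} (hp : p ∈ Strip D κ₀) :
    ((∀ μ, |(p μ).re| < ρ₀ / 2) ∧ IsUnit (arrowMat (innerArrow N p)) ∧ ‖(arrowMat (innerArrow N p))⁻¹‖ ≤ 2 * aZ) ∨
      ((∃ μ, ρ₀ / 2 ≤ |(p μ).re|) ∧ reVec p ≠ 0 ∧ IsUnit (arrowMat (outerArrow N (reVec p) p)) ∧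
        ‖(arrowMat (outerArrow N (reVec p) p))⁻¹‖ ≤ 2 * aR) :=
  apriori_on_strip (fun p => arrowMat (innerArrow N p)) (fun q p => arrowMat (outerArrow N q p)) ω
    hF3 hF4 hF5 hF6 hω haZ haR hcOut hρ₀ hρ hsmallIn hκ₀ hκ hκη hsmallOut hp

end OneN

/-! ## §3 (U1) at one `N`, as a function of the four rows -/

section Det

variable {d : ℕ} {N : ℕ} [NeZero N]

/-- [folklore] **(U1) AT ONE `N` FROM ROWS F3–F6**: under the hypotheses of `apriori_of_rows` (dimension `D = d+1`), the Bloch-fibre determinant of the U = 1 KKT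
stencil has no zero on `Strip (d+1) κ₀` — F1c's `det_ne_zero_of_isUnit_innerArrow` in the inner case, `det_ne_zero_of_isUnit_outerArrow` (anchor
`reVec p ∈ BZ ∖ {0}`, so the outer scaling is nondegenerate) in the outer case. -/
theorem det_ne_zero_of_rows {aZ aR cIn cOut ρ₁ η₁ ρ₀ κ₀ Ω : ℝ} (ω : (Fin (d + 1) → ℝ) → ℝ)
    (hF3 : IsUnit (arrowMat (innerArrow N (0 : Fin (d + 1) → ℂ))) ∧ ‖(arrowMat (innerArrow N (0 : Fin (d + 1) → ℂ)))⁻¹‖ ≤ aZ)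
    (hF4 : ∀ (p : Fin (d + 1) → ℂ) (r : ℝ), (∀ μ, ‖p μ‖ ≤ r) → r ≤ ρ₁ →
      ‖arrowMat (innerArrow N p) - arrowMat (innerArrow N 0)‖ ≤ cIn * r)
    (hF5 : ∀ q ∈ BZ (d + 1), q ≠ 0 → IsUnit (arrowMat (outerArrow N q (ofRealVec q))) ∧ ‖(arrowMat (outerArrow N q (ofRealVec q)))⁻¹‖ ≤ aR)
    (hF6 : ∀ q ∈ BZ (d + 1), q ≠ 0 → ∀ p : Fin (d + 1) → ℂ, reVec p = q → ∀ η : ℝ, 0 ≤ η → η ≤ η₁ → (∀ μ, |(p μ).im| ≤ η) →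
      ‖arrowMat (outerArrow N q p) - arrowMat (outerArrow N q (ofRealVec q))‖ ≤ cOut * η * ω q)
    (hω : ∀ q ∈ BZ (d + 1), (∃ μ, ρ₀ / 2 ≤ |q μ|) → ω q ≤ Ω)
    (haZ : 0 ≤ aZ) (haR : 0 ≤ aR) (hcOut : 0 ≤ cOut) (hρ₀ : 0 < ρ₀) (hρ : ρ₀ ≤ ρ₁) (hsmallIn : 2 * aZ * cIn * ρ₀ ≤ 1)
    (hκ₀ : 0 ≤ κ₀) (hκ : κ₀ ≤ ρ₀ / 2) (hκη : κ₀ ≤ η₁) (hsmallOut : 2 * aR * cOut * κ₀ * Ω ≤ 1) :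
    ∀ p ∈ Strip (d + 1) κ₀, (trigPolySymbol (stencil (d + 1)) (pieceMatrix (N := N)) p).det ≠ 0 :=
  of_strip (fun p => (trigPolySymbol (stencil (d + 1)) (pieceMatrix (N := N)) p).det ≠ 0)
    (fun p => arrowMat (innerArrow N p)) (fun q p => arrowMat (outerArrow N q p)) ω
    (fun p hU => det_ne_zero_of_isUnit_innerArrow p hU)
    (fun p hq hq0 hU => det_ne_zero_of_isUnit_outerArrow (abs_le_pi_of_mem_BZ hq) hq0 p hU)
    hF3 hF4 hF5 hF6 hω haZ haR hcOut hρ₀ hρ hsmallIn hκ₀ hκ hκη hsmallOut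

end Det

/-! ## §4 (U1) uniformly in the step `j` (`N = Lc^(j+1)`): the `hdet` hypothesis of `stripRegularK_of_det_bound` -/

section Steps

variable {d Lc : ℕ} [NeZero Lc]

/-- [folklore] **(U1) = `DetStrip d Lc κ₀` FROM ROWS F3–F6 AT EVERY STEP.**  If the four rows hold at every box side `N = Lc^(j+1)` with `j`-INDEPENDENT constants
`aZ, cIn, ρ₁, aR, cOut, η₁` (and modulus `ω`/bound `Ω`), and `(ρ₀, κ₀)` satisfy the smallness inequalities, then for every `j` the Bloch-fibre determinant at
`N = Lc^(j+1)` has no zero on `Strip (d+1) κ₀` — LITERALLY the hypothesis `hdet` of `StripRegularPackaging.stripRegularK_of_det_bound` (the typer's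
`DetStrip d Lc κ₀`), with ONE `κ₀` outside `∀ j`. -/
theorem detStrip_of_rows {aZ aR cIn cOut ρ₁ η₁ ρ₀ κ₀ Ω : ℝ} (ω : (Fin (d + 1) → ℝ) → ℝ)
    (hF3 : ∀ j : ℕ, IsUnit (arrowMat (innerArrow (Lc ^ (j + 1)) (0 : Fin (d + 1) → ℂ))) ∧
      ‖(arrowMat (innerArrow (Lc ^ (j + 1)) (0 : Fin (d + 1) → ℂ)))⁻¹‖ ≤ aZ)
    (hF4 : ∀ (j : ℕ) (p : Fin (d + 1) → ℂ) (r : ℝ), (∀ μ, ‖p μ‖ ≤ r) → r ≤ ρ₁ →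
      ‖arrowMat (innerArrow (Lc ^ (j + 1)) p) - arrowMat (innerArrow (Lc ^ (j + 1)) 0)‖ ≤ cIn * r)
    (hF5 : ∀ (j : ℕ), ∀ q ∈ BZ (d + 1), q ≠ 0 → IsUnit (arrowMat (outerArrow (Lc ^ (j + 1)) q (ofRealVec q))) ∧
      ‖(arrowMat (outerArrow (Lc ^ (j + 1)) q (ofRealVec q)))⁻¹‖ ≤ aR)
    (hF6 : ∀ (j : ℕ), ∀ q ∈ BZ (d + 1), q ≠ 0 → ∀ p : Fin (d + 1) → ℂ, reVec p = q → ∀ η : ℝ, 0 ≤ η → η ≤ η₁ → (∀ μ, |(p μ).im| ≤ η) →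
      ‖arrowMat (outerArrow (Lc ^ (j + 1)) q p) - arrowMat (outerArrow (Lc ^ (j + 1)) q (ofRealVec q))‖ ≤ cOut * η * ω q)
    (hω : ∀ q ∈ BZ (d + 1), (∃ μ, ρ₀ / 2 ≤ |q μ|) → ω q ≤ Ω)
    (haZ : 0 ≤ aZ) (haR : 0 ≤ aR) (hcOut : 0 ≤ cOut) (hρ₀ : 0 < ρ₀) (hρ : ρ₀ ≤ ρ₁) (hsmallIn : 2 * aZ * cIn * ρ₀ ≤ 1)
    (hκ₀ : 0 ≤ κ₀) (hκ : κ₀ ≤ ρ₀ / 2) (hκη : κ₀ ≤ η₁) (hsmallOut : 2 * aR * cOut * κ₀ * Ω ≤ 1) :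
    ∀ j : ℕ, ∀ p ∈ Strip (d + 1) κ₀, (trigPolySymbol (stencil (d + 1)) (pieceMatrix (N := Lc ^ (j + 1))) p).det ≠ 0 := fun j =>
  det_ne_zero_of_rows ω (hF3 j) (hF4 j) (hF5 j) (hF6 j) hω haZ haR hcOut hρ₀ hρ hsmallIn hκ₀ hκ hκη hsmallOut

/-- [folklore] **THE `j`-INDEXED A-PRIORI BOUND FOR ROW F8**: under the same hypotheses, at every step `j` and every `p ∈ Strip (d+1) κ₀`, the inner-scaled
(`|Re p|∞ < ρ₀/2`) or the outer-scaled (anchored at `reVec p ≠ 0`) arrow matrix at `N = Lc^(j+1)` is invertible with `‖inverse‖ ≤ 2aZ` resp. `≤ 2aR`. -/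
theorem apriori_of_rows_step {aZ aR cIn cOut ρ₁ η₁ ρ₀ κ₀ Ω : ℝ} (ω : (Fin (d + 1) → ℝ) → ℝ)
    (hF3 : ∀ j : ℕ, IsUnit (arrowMat (innerArrow (Lc ^ (j + 1)) (0 : Fin (d + 1) → ℂ))) ∧
      ‖(arrowMat (innerArrow (Lc ^ (j + 1)) (0 : Fin (d + 1) → ℂ)))⁻¹‖ ≤ aZ)
    (hF4 : ∀ (j : ℕ) (p : Fin (d + 1) → ℂ) (r : ℝ), (∀ μ, ‖p μ‖ ≤ r) → r ≤ ρ₁ →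
      ‖arrowMat (innerArrow (Lc ^ (j + 1)) p) - arrowMat (innerArrow (Lc ^ (j + 1)) 0)‖ ≤ cIn * r)
    (hF5 : ∀ (j : ℕ), ∀ q ∈ BZ (d + 1), q ≠ 0 → IsUnit (arrowMat (outerArrow (Lc ^ (j + 1)) q (ofRealVec q))) ∧
      ‖(arrowMat (outerArrow (Lc ^ (j + 1)) q (ofRealVec q)))⁻¹‖ ≤ aR)
    (hF6 : ∀ (j : ℕ), ∀ q ∈ BZ (d + 1), q ≠ 0 → ∀ p : Fin (d + 1) → ℂ, reVec p = q → ∀ η : ℝ, 0 ≤ η → η ≤ η₁ → (∀ μ, |(p μ).im| ≤ η) →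
      ‖arrowMat (outerArrow (Lc ^ (j + 1)) q p) - arrowMat (outerArrow (Lc ^ (j + 1)) q (ofRealVec q))‖ ≤ cOut * η * ω q)
    (hω : ∀ q ∈ BZ (d + 1), (∃ μ, ρ₀ / 2 ≤ |q μ|) → ω q ≤ Ω)
    (haZ : 0 ≤ aZ) (haR : 0 ≤ aR) (hcOut : 0 ≤ cOut) (hρ₀ : 0 < ρ₀) (hρ : ρ₀ ≤ ρ₁) (hsmallIn : 2 * aZ * cIn * ρ₀ ≤ 1)
    (hκ₀ : 0 ≤ κ₀) (hκ : κ₀ ≤ ρ₀ / 2) (hκη : κ₀ ≤ η₁) (hsmallOut : 2 * aR * cOut * κ₀ * Ω ≤ 1)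
    (j : ℕ) {p : Fin (d + 1) → ℂ} (hp : p ∈ Strip (d + 1) κ₀) :
    ((∀ μ, |(p μ).re| < ρ₀ / 2) ∧ IsUnit (arrowMat (innerArrow (Lc ^ (j + 1)) p)) ∧
        ‖(arrowMat (innerArrow (Lc ^ (j + 1)) p))⁻¹‖ ≤ 2 * aZ) ∨
      ((∃ μ, ρ₀ / 2 ≤ |(p μ).re|) ∧ reVec p ≠ 0 ∧ IsUnit (arrowMat (outerArrow (Lc ^ (j + 1)) (reVec p) p)) ∧
        ‖(arrowMat (outerArrow (Lc ^ (j + 1)) (reVec p) p))⁻¹‖ ≤ 2 * aR) :=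
  apriori_of_rows ω (hF3 j) (hF4 j) (hF5 j) (hF6 j) hω haZ haR hcOut hρ₀ hρ hsmallIn hκ₀ hκ hκη hsmallOut hp

end Steps

end Summit.QuantumFields.BalabanUV.Beta.GAN24.FibreDetStrip

end
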